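import Mathlib
import Summits.Ventures.PercRepro2.Defs

/-!
# Two edges in series: the pinning identity (blind cell PercRepro2, night-1 g14; NIGHT1-G14.md §14)

For two edges `f ≠ f'` and an event `A` that does not see `f` when `f'` is closed (`h10`: pinning
`f` to `1` or to `0` gives the same probability under `p[f' ↦ 0]`) and does not see `f'` when `f`
is closed (`h01`), the probability of `A` depends on the two weights only through their PRODUCT:
`P_p(A) = P_{p[f ↦ p f · p f', f' ↦ 1]}(A)` (`prob_series`; `expect_series` for observables).  This is the probabilistic half of a series reduction
(a pendant path `a₃ – v – u` through an unmarked vertex `v` of degree `2` reduces to one edge of weight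
`q t`); the event-specific hypotheses are supplied by the leaf-invisibility lemmas of the tree.
-/

namespace Summit.Ventures.PercRepro2

namespace SeriesPin

variable {E : Type*} [Fintype E] [DecidableEq E] {R : Type*} [CommRing R]

/-- **Two edges in series.** -/
theorem prob_series (p : E → R) {f f' : E} (hff : f ≠ f') (A : Set (Config E))
    (h10 : prob (Function.update (Function.update p f' 0) f 1) A =
      prob (Function.update (Function.update p f' 0) f 0) A)
    (h01 : prob (Function.update (Function.update p f 0) f' 1) A =
      prob (Function.update (Function.update p f 0) f' 0) A) :
    prob p A = prob (Function.update (Function.update p f (p f * p f')) f' 1) A := by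
  -- the left side: pin `f'`, then `f`
  have hL := prob_eq_pin p A f'
  have hL1 := prob_eq_pin (Function.update p f' 1) A f
  have hL0 := prob_eq_pin (Function.update p f' 0) A f
  -- the right side: pin `f'` (sure), then `f`
  set q := p f with hq
  set t := p f' with ht
  set p' := Function.update (Function.update p f (q * t)) f' 1 with hp'
  have hR := prob_eq_pin p' A f'
  have hR1 := prob_eq_pin (Function.update p' f' 1) A f
  have e1 : (Function.update p f' 1) f = q := by rw [Function.update_of_ne hff]
  have e0 : (Function.update p f' 0) f = q := by rw [Function.update_of_ne hff]
  have e2 : p' f' = 1 := by rw [hp', Function.update_self]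
  have e3 : (Function.update p' f' 1) f = q * t := by
    rw [Function.update_of_ne hff, hp', Function.update_of_ne hff, Function.update_self]
  -- the four corner probabilities, in the canonical order `f'` inside, `f` outside
  have c11 : Function.update (Function.update p' f' 1) f 1 =
      Function.update (Function.update p f' 1) f 1 := by
    rw [hp', Function.update_idem, Function.update_comm hff.symm, Function.update_idem,
      Function.update_comm hff]
  have c01 : Function.update (Function.update p' f' 1) f 0 =
      Function.update (Function.update p f' 1) f 0 := by
    rw [hp', Function.update_idem, Function.update_comm hff.symm, Function.update_idem,
      Function.update_comm hff]
  have h01' : prob (Function.update (Function.update p f' 1) f 0) A =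
      prob (Function.update (Function.update p f' 0) f 0) A := by
    rw [Function.update_comm hff.symm, Function.update_comm hff.symm]
    exact h01
  rw [hL, hL1, hL0, e1, e0, h10, h01']
  rw [hR, hR1, e2, e3, c11, c01, h01']
  ring

/-- **Two edges in series**, for expectations. -/
theorem expect_series (p : E → R) {f f' : E} (hff : f ≠ f') (G : Config E → R)
    (h10 : expect (Function.update (Function.update p f' 0) f 1) G =
      expect (Function.update (Function.update p f' 0) f 0) G)
    (h01 : expect (Function.update (Function.update p f 0) f' 1) G =
      expect (Function.update (Function.update p f 0) f' 0) G) :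
    expect p G = expect (Function.update (Function.update p f (p f * p f')) f' 1) G := by
  -- the left side: pin `f'`, then `f`
  have hL := expect_eq_pin p G f'
  have hL1 := expect_eq_pin (Function.update p f' 1) G f
  have hL0 := expect_eq_pin (Function.update p f' 0) G f
  -- the right side: pin `f'` (sure), then `f`
  set q := p f with hq
  set t := p f' with ht
  set p' := Function.update (Function.update p f (q * t)) f' 1 with hp'
  have hR := expect_eq_pin p' G f'
  have hR1 := expect_eq_pin (Function.update p' f' 1) G f
  have e1 : (Function.update p f' 1) f = q := by rw [Function.update_of_ne hff]
  have e0 : (Function.update p f' 0) f = q := by rw [Function.update_of_ne hff]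
  have e2 : p' f' = 1 := by rw [hp', Function.update_self]
  have e3 : (Function.update p' f' 1) f = q * t := by
    rw [Function.update_of_ne hff, hp', Function.update_of_ne hff, Function.update_self]
  -- the four corner probabilities, in the canonical order `f'` inside, `f` outside
  have c11 : Function.update (Function.update p' f' 1) f 1 =
      Function.update (Function.update p f' 1) f 1 := by
    rw [hp', Function.update_idem, Function.update_comm hff.symm, Function.update_idem,
      Function.update_comm hff]
  have c01 : Function.update (Function.update p' f' 1) f 0 =
      Function.update (Function.update p f' 1) f 0 := by
    rw [hp', Function.update_idem, Function.update_comm hff.symm, Function.update_idem,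
      Function.update_comm hff]
  have h01' : expect (Function.update (Function.update p f' 1) f 0) G =
      expect (Function.update (Function.update p f' 0) f 0) G := by
    rw [Function.update_comm hff.symm, Function.update_comm hff.symm]
    exact h01
  rw [hL, hL1, hL0, e1, e0, h10, h01']
  rw [hR, hR1, e2, e3, c11, c01, h01']
  ring

end SeriesPin

end Summit.Ventures.PercRepro2
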